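import Summits.KontsevichZagierPeriods.KontsevichZagierPeriods.Theorems.SoloBlindCyclicForm
import Summits.KontsevichZagierPeriods.KontsevichZagierPeriods.Theorems.SoloBlindNthRoot
import HarnessLib

/-!
# The two-exponent form `z^α (1-z)^β dz` on the half-plane, II: semialgebraicity

For `α = k/N - 1`, `β = l/N - 1` the real and imaginary parts of `g_{αβ}(x+iy) = z^α (1-z)^β`
and the real part of `g_{αβ}'(x+iy)` are `ℚ`-semialgebraic functions of `(x, y)` on the closed
half-plane `Eup = {y ≥ 0, x ≤ ½} ∖ {0}`.  Mechanism: `z^{k/N-1} = (z^{1/N})^k / z` with `z^{1/N}`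
semialgebraic on the closed upper half-plane (`SoloBlindNthRoot`), and for the mirror factor,
whose argument `1 - z` lies in the LOWER half-plane, `(1-z)^β = conj( (conj(1-z))^β )` with
`conj(1-z) = (1-x) + iy` back in the upper half-plane (`Re (1-z) ≥ ½ > 0`, so no cut is met).

References: Bochnak–Coste–Roy, *Real Algebraic Geometry*, §2.2; Kontsevich–Zagier (2001), §1.2.
-/

noncomputable section

open Set Complex MeasureTheory
open scoped ComplexConjugate
open Literature.ModelTheory.ExponentialFields MvPolynomial
open Literature.NumberTheory.Transcendental
open Literature.NumberTheory.Transcendental.KZ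

namespace Summit.KontsevichZagierPeriods.KontsevichZagierPeriods.Theorems

namespace SoloBlind

/-! ## Kit: conjugates and differences -/

section Kit

variable {d : ℕ} {W : Set (Fin d → ℝ)} {F G : (Fin d → ℝ) → ℂ}

/-- Real and imaginary parts of the conjugate. -/
theorem sa_conj (hFr : IsSemialgebraicFunOn ℚ W fun z => (F z).re)
    (hFi : IsSemialgebraicFunOn ℚ W fun z => (F z).im) :
    IsSemialgebraicFunOn ℚ W (fun z => (conj (F z)).re) ∧
      IsSemialgebraicFunOn ℚ W (fun z => (conj (F z)).im) :=
  ⟨hFr.congr fun z _ => by simp, hFi.fun_neg.congr fun z _ => by simp⟩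

/-- Real and imaginary parts of a difference. -/
theorem sa_sub (hFr : IsSemialgebraicFunOn ℚ W fun z => (F z).re)
    (hFi : IsSemialgebraicFunOn ℚ W fun z => (F z).im)
    (hGr : IsSemialgebraicFunOn ℚ W fun z => (G z).re)
    (hGi : IsSemialgebraicFunOn ℚ W fun z => (G z).im) :
    IsSemialgebraicFunOn ℚ W (fun z => (F z - G z).re) ∧
      IsSemialgebraicFunOn ℚ W (fun z => (F z - G z).im) :=
  ⟨(hFr.fun_sub hGr).congr fun z _ => by simp, (hFi.fun_sub hGi).congr fun z _ => by simp⟩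

end Kit

/-! ## The exponents and the two upper half-plane arguments -/

/-- The exponent `k/N - 1`. -/
def cycExp (N k : ℕ) : ℝ := (k : ℝ) / N - 1

/-- `k/N - 1` as a cast rational. -/
theorem cycExp_cast (N k : ℕ) : ((((k : ℚ) / N - 1 : ℚ)) : ℝ) = cycExp N k := by
  rw [cycExp]; push_cast; ring

/-- `z^{k/N - 1} = (z^{1/N})^k · z⁻¹` for `z ≠ 0`. -/
theorem cpow_cycExp_eq {N : ℕ} (k : ℕ) {ζ : ℂ} (hζ : ζ ≠ 0) :
    ζ ^ ((cycExp N k : ℝ) : ℂ) = rootN N ζ ^ k * ζ⁻¹ := by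
  rw [rootN_pow_eq, cycExp, show ((((k : ℝ) / N - 1 : ℝ)) : ℂ) = ((((k : ℝ) / N : ℝ)) : ℂ) - 1 by
    push_cast; ring, cpow_sub _ _ hζ, cpow_one, div_eq_mul_inv]

/-- `Eup ⊆ upper0`. -/
theorem Eup_subset_upper0 : Eup ⊆ upper0 := fun _ hz => ⟨hz.1, hz.2.2⟩

/-- The mirror map `(x, y) ↦ (1 - x, y)`. -/
def refl2 (z : Fin 2 → ℝ) : Fin 2 → ℝ := ![1 - z 0, z 1]

/-- `refl2` is a polynomial map. -/
theorem isSemialgebraicMapOn_refl2 : IsSemialgebraicMapOn ℚ Eup refl2 := by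
  refine IsSemialgebraicMapOn.of_forall isSemialgebraic_Eup fun j => ?_
  fin_cases j
  · exact (isSemialgebraicFunOn_aeval isSemialgebraic_Eup
      (1 - X 0 : MvPolynomial (Fin 2) ℚ)).congr fun z _ => by simp [refl2]
  · exact (isSemialgebraicFunOn_aeval isSemialgebraic_Eup
      (X 1 : MvPolynomial (Fin 2) ℚ)).congr fun z _ => by simp [refl2]

/-- `refl2` maps `Eup` into `upper0` (indeed into `Re ≥ ½`). -/
theorem refl2_mapsTo : MapsTo refl2 Eup upper0 := fun z hz =>
  ⟨by simpa [refl2] using hz.1, Or.inr (by simp [refl2]; linarith [hz.2.1])⟩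

/-- On `Eup`, `z ≠ 0`. -/
theorem zeta_ne_zero {z : Fin 2 → ℝ} (hz : z ∈ Eup) : (z 0 : ℂ) + z 1 * I ≠ 0 :=
  (upper0_ne_zero (Eup_subset_upper0 hz)).1

/-- On `Eup`, `w = (1-x) + iy ≠ 0`, and `Re w > 0`. -/
theorem mirror_ne_zero {z : Fin 2 → ℝ} (hz : z ∈ Eup) :
    (1 - (z 0 : ℂ)) + z 1 * I ≠ 0 ∧ 0 < ((1 - (z 0 : ℂ)) + z 1 * I).re := by
  refine ⟨?_, by simp; linarith [hz.2.1]⟩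
  have h := (upper0_ne_zero (refl2_mapsTo hz)).1
  simpa [refl2] using h

/-- `1 - z = conj w`, `w = (1-x) + iy`. -/
theorem one_sub_zeta_eq (z : Fin 2 → ℝ) :
    1 - ((z 0 : ℂ) + z 1 * I) = conj ((1 - (z 0 : ℂ)) + z 1 * I) := by
  apply Complex.ext <;> simp

/-- The mirror factor through the upper half-plane:
`(1-z)^{l/N-1} = conj( (w^{1/N})^l · w⁻¹ )`, `w = (1-x) + iy`. -/
theorem one_sub_cpow_cycExp_eq {N : ℕ} (l : ℕ) {z : Fin 2 → ℝ} (hz : z ∈ Eup) :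
    (1 - ((z 0 : ℂ) + z 1 * I)) ^ ((cycExp N l : ℝ) : ℂ) =
      conj (rootN N ((1 - (z 0 : ℂ)) + z 1 * I) ^ l * ((1 - (z 0 : ℂ)) + z 1 * I)⁻¹) := by
  obtain ⟨hw0, hwre⟩ := mirror_ne_zero hz
  have harg : ((1 - (z 0 : ℂ)) + z 1 * I).arg ≠ Real.pi := fun h => by
    have h' := (arg_eq_pi_iff.mp h).1
    linarith
  have hc := conj_cpow ((1 - (z 0 : ℂ)) + z 1 * I) ((cycExp N l : ℝ) : ℂ) harg
  rw [conj_ofReal] at hc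
  rw [one_sub_zeta_eq, hc, cpow_cycExp_eq l hw0]

/-! ## Semialgebraicity of the factors -/

/-- Real and imaginary parts of `z^{k/N-1}` on `Eup`. -/
theorem sa_cpow_cycExp {N : ℕ} (hN : 2 ≤ N) (k : ℕ) :
    IsSemialgebraicFunOn ℚ Eup (fun z => (((z 0 : ℂ) + z 1 * I) ^ ((cycExp N k : ℝ) : ℂ)).re) ∧
      IsSemialgebraicFunOn ℚ Eup
        (fun z => (((z 0 : ℂ) + z 1 * I) ^ ((cycExp N k : ℝ) : ℂ)).im) := by
  have hr := (isSemialgebraicFunOn_rootNRe hN).mono Eup_subset_upper0 isSemialgebraic_Eup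
  have hi := (isSemialgebraicFunOn_rootNIm hN).mono Eup_subset_upper0 isSemialgebraic_Eup
  obtain ⟨hpr, hpi⟩ := sa_pow (F := fun z => rootN N ((z 0 : ℂ) + z 1 * I)) hr hi k
  have hlr : IsSemialgebraicFunOn ℚ Eup fun z => ((z 0 : ℂ) + z 1 * I).re :=
    (isSemialgebraicFunOn_aeval isSemialgebraic_Eup (X 0 : MvPolynomial (Fin 2) ℚ)).congr
      fun z _ => by simp
  have hli : IsSemialgebraicFunOn ℚ Eup fun z => ((z 0 : ℂ) + z 1 * I).im :=
    (isSemialgebraicFunOn_aeval isSemialgebraic_Eup (X 1 : MvPolynomial (Fin 2) ℚ)).congr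
      fun z _ => by simp
  obtain ⟨hir, hii⟩ := sa_inv hlr hli
  obtain ⟨hmr, hmi⟩ := sa_mul hpr hpi hir hii
  exact ⟨hmr.congr fun z hz => by rw [cpow_cycExp_eq k (zeta_ne_zero hz)],
    hmi.congr fun z hz => by rw [cpow_cycExp_eq k (zeta_ne_zero hz)]⟩

/-- Real and imaginary parts of `(1-z)^{l/N-1}` on `Eup`. -/
theorem sa_one_sub_cpow_cycExp {N : ℕ} (hN : 2 ≤ N) (l : ℕ) :
    IsSemialgebraicFunOn ℚ Eup
        (fun z => ((1 - ((z 0 : ℂ) + z 1 * I)) ^ ((cycExp N l : ℝ) : ℂ)).re) ∧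
      IsSemialgebraicFunOn ℚ Eup
        (fun z => ((1 - ((z 0 : ℂ) + z 1 * I)) ^ ((cycExp N l : ℝ) : ℂ)).im) := by
  have hr := ((isSemialgebraicFunOn_rootNRe hN).comp_isSemialgebraicMapOn_holds
    isSemialgebraicMapOn_refl2 refl2_mapsTo).congr (g := fun z : Fin 2 → ℝ =>
      (rootN N ((1 - (z 0 : ℂ)) + z 1 * I)).re) fun z _ => by simp [rootNRe, refl2]
  have hi := ((isSemialgebraicFunOn_rootNIm hN).comp_isSemialgebraicMapOn_holds
    isSemialgebraicMapOn_refl2 refl2_mapsTo).congr (g := fun z : Fin 2 → ℝ =>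
      (rootN N ((1 - (z 0 : ℂ)) + z 1 * I)).im) fun z _ => by simp [rootNIm, refl2]
  obtain ⟨hpr, hpi⟩ := sa_pow (F := fun z => rootN N ((1 - (z 0 : ℂ)) + z 1 * I)) hr hi l
  have hlr : IsSemialgebraicFunOn ℚ Eup fun z => ((1 - (z 0 : ℂ)) + z 1 * I).re :=
    (isSemialgebraicFunOn_aeval isSemialgebraic_Eup (1 - X 0 : MvPolynomial (Fin 2) ℚ)).congr
      fun z _ => by simp
  have hli : IsSemialgebraicFunOn ℚ Eup fun z => ((1 - (z 0 : ℂ)) + z 1 * I).im :=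
    (isSemialgebraicFunOn_aeval isSemialgebraic_Eup (X 1 : MvPolynomial (Fin 2) ℚ)).congr
      fun z _ => by simp
  obtain ⟨hir, hii⟩ := sa_inv hlr hli
  obtain ⟨hmr, hmi⟩ := sa_mul hpr hpi hir hii
  obtain ⟨hcr, hci⟩ := sa_conj hmr hmi
  exact ⟨hcr.congr fun z hz => by rw [one_sub_cpow_cycExp_eq l hz],
    hci.congr fun z hz => by rw [one_sub_cpow_cycExp_eq l hz]⟩

/-! ## Semialgebraicity of `g_{αβ}` and of `Re g_{αβ}'` -/

/-- **Real and imaginary parts of `g_{k/N-1, l/N-1}(x+iy)` are `ℚ`-semialgebraic on `Eup`.** -/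
theorem sa_gTwo {N : ℕ} (hN : 2 ≤ N) (k l : ℕ) :
    IsSemialgebraicFunOn ℚ Eup
        (fun z => (gTwo (cycExp N k) (cycExp N l) ((z 0 : ℂ) + z 1 * I)).re) ∧
      IsSemialgebraicFunOn ℚ Eup
        (fun z => (gTwo (cycExp N k) (cycExp N l) ((z 0 : ℂ) + z 1 * I)).im) := by
  obtain ⟨h1r, h1i⟩ := sa_cpow_cycExp hN k
  obtain ⟨h2r, h2i⟩ := sa_one_sub_cpow_cycExp hN l
  obtain ⟨hr, hi⟩ := sa_mul h1r h1i h2r h2i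
  exact ⟨hr.congr fun z _ => by rw [gTwo], hi.congr fun z _ => by rw [gTwo]⟩

/-- `g' = g · (α/z - β/(1-z))` off `{0, 1}`. -/
theorem gTwoDer_eq_mul {α β : ℝ} {ζ : ℂ} (h0 : ζ ≠ 0) (h1 : 1 - ζ ≠ 0) :
    gTwoDer α β ζ = gTwo α β ζ * ((α : ℂ) * ζ⁻¹ - (β : ℂ) * (1 - ζ)⁻¹) := by
  rw [gTwoDer, gTwo, cpow_sub _ _ h0, cpow_sub _ _ h1, cpow_one, cpow_one, div_eq_mul_inv,
    div_eq_mul_inv]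
  ring

/-- **The real part of `g_{k/N-1, l/N-1}'(x+iy)` is `ℚ`-semialgebraic on `Eup`.** -/
theorem sa_re_gTwoDer {N : ℕ} (hN : 2 ≤ N) (k l : ℕ) :
    IsSemialgebraicFunOn ℚ Eup
      (fun z => (gTwoDer (cycExp N k) (cycExp N l) ((z 0 : ℂ) + z 1 * I)).re) := by
  obtain ⟨hgr, hgi⟩ := sa_gTwo hN k l
  have hlr : IsSemialgebraicFunOn ℚ Eup fun z => ((z 0 : ℂ) + z 1 * I).re :=
    (isSemialgebraicFunOn_aeval isSemialgebraic_Eup (X 0 : MvPolynomial (Fin 2) ℚ)).congr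
      fun z _ => by simp
  have hli : IsSemialgebraicFunOn ℚ Eup fun z => ((z 0 : ℂ) + z 1 * I).im :=
    (isSemialgebraicFunOn_aeval isSemialgebraic_Eup (X 1 : MvPolynomial (Fin 2) ℚ)).congr
      fun z _ => by simp
  have hmr : IsSemialgebraicFunOn ℚ Eup fun z => (1 - ((z 0 : ℂ) + z 1 * I)).re :=
    (isSemialgebraicFunOn_aeval isSemialgebraic_Eup (1 - X 0 : MvPolynomial (Fin 2) ℚ)).congr
      fun z _ => by simp
  have hmi : IsSemialgebraicFunOn ℚ Eup fun z => (1 - ((z 0 : ℂ) + z 1 * I)).im :=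
    (isSemialgebraicFunOn_aeval isSemialgebraic_Eup (-X 1 : MvPolynomial (Fin 2) ℚ)).congr
      fun z _ => by simp
  obtain ⟨hizr, hizi⟩ := sa_inv hlr hli
  obtain ⟨himr, himi⟩ := sa_inv hmr hmi
  obtain ⟨har, hai⟩ := sa_ofReal ((isSemialgebraicFunOn_const_ratCast isSemialgebraic_Eup
    ((k : ℚ) / N - 1)).congr (g := fun _ => cycExp N k) fun _ _ => cycExp_cast N k)
  obtain ⟨hbr, hbi⟩ := sa_ofReal ((isSemialgebraicFunOn_const_ratCast isSemialgebraic_Eup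
    ((l : ℚ) / N - 1)).congr (g := fun _ => cycExp N l) fun _ _ => cycExp_cast N l)
  obtain ⟨h1r, h1i⟩ := sa_mul har hai hizr hizi
  obtain ⟨h2r, h2i⟩ := sa_mul hbr hbi himr himi
  obtain ⟨hdr, hdi⟩ := sa_sub h1r h1i h2r h2i
  obtain ⟨hr, -⟩ := sa_mul hgr hgi hdr hdi
  refine hr.congr fun z hz => ?_
  have h1 : 1 - ((z 0 : ℂ) + z 1 * I) ≠ 0 := by
    rw [one_sub_zeta_eq]
    exact (map_ne_zero_iff _ (RingHom.injective _)).mpr (mirror_ne_zero hz).1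
  rw [gTwoDer_eq_mul (zeta_ne_zero hz) h1]

end SoloBlind

end Summit.KontsevichZagierPeriods.KontsevichZagierPeriods.Theorems
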